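import Summits.FinalStateConjecture.FinalStateConjecture.Theorems.EIHFluxBalanceInertialRecessionStubSlaving12RelRicciC3
import Summits.FinalStateConjecture.FinalStateConjecture.Theorems.EIHFluxBalanceInertialRecessionStubSlavingCOERMomSlot
import Literature.Geometry.Lorentzian.KerrSchildChartCovariance

/-!
# Route EIHFluxBalance — `InertialRecession` (E′), line `SketchCleanExcision`, skeleton r13,
# stub `stub_momCapstone` (A): the momentum rows as functions on JET SPACE

Helper file for the crux `stmt-FinalStateConjecture-17403`
(`Summit.FinalStateConjecture.FinalStateConjecture.Theses.EIHFluxBalance.InertialRecession`, E′),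
registered stub `stub_momCapstone` (A) of skeleton r13. The stub bounds the momentum rows
`Ric(g₀)(x)(♯dx⁰, e_j)` of the frozen ansatz LINEARLY in its first jet; its proof reads the rows as
the values of the smooth function `Ψ(J) = ricciJet J (J-value⁻¹ n) e` (`CoordRicciJet.lean`) on the
`2`-jets at the base point `0`, and transfers the two halves of the registered momentum-row lemma
`stub_momRowLinear` (ML, taken here as HYPOTHESES `hML₁`, `hML₂` in their registered form) from
fields to jets by realising jets as quadratic Taylor fields (`MetricCoord.taylor2`,
`isMetricOn_taylor2`):

* `momCap_taylor_realize`, `momCap_perturb_symm` — a symmetric jet `(B, D₁, D₂)` with invertible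
  value is the `2`-jet at `0` of metric components, and so is its perturbation along a covector `n`
  by symmetric normal data `(A, P, W)`;
* `momCap_jetML₂` — ML(ii) on jet space: `|Ψ(J + ι(A,P,W)) − Ψ(J)| ≤ C(1 + ‖D₁‖)(‖A‖ + ‖P‖)‖n‖²‖e‖`;
* `momCap_jetML₁_hom` — ML(i) on jet space (homogeneity): `Ψ(J + ι(cA, cP, W)) − Ψ(J) = c (Ψ(J + ι(A, P, W')) − Ψ(J))`;
* `momCap_ricAt_eq_ricciJet_zero` — `Ric(G)(x)(♯n, e) = Ψ(0, G x, DG x, D²G x)` (translation to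
  the base point `0`, `ricAt_comp_zoom_eq` with factor `1`);
* `momCap_decomp₁`, `momCap_decomp₂`, `momCap_norm_proj_le` — the split of a jet into SLICE data
  (composition with the projection `π v = v − v⁰ e₀`) and NORMAL data `(D₁ e₀, D₂ e₀ ∘ π, D₂ e₀ e₀)`
  along `dx⁰`, and `‖π v‖ ≤ ‖v‖`.

No definitions, no named facts, no `sorry`.
-/

set_option linter.dupNamespace false
set_option maxSynthPendingDepth 6
set_option synthInstance.maxHeartbeats 200000

noncomputable section

namespace Summit.FinalStateConjecture.FinalStateConjecture.Theorems.SublinearIsFree.Slaving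

open scoped BigOperators Topology ContDiff
open Filter Set Function Metric Literature.Geometry.Lorentzian
  Literature.Geometry.Lorentzian.MetricCoord
open Summit.FinalStateConjecture.FinalStateConjecture.Theorems

/-! ### Realising symmetric jets by quadratic Taylor fields -/

/-- **A symmetric `2`-jet with invertible value is the jet at `0` of metric components**: the
quadratic Taylor field `taylor2 0 B D₁ D₂` is a field of metric components on the open set where it
is invertible, which contains `0`, with value `B`, first derivative `D₁` and second derivative
`D₂` at `0` (`isMetricOn_taylor2`, `fderiv_fderiv_taylor2`). [folklore] -/
theorem momCap_taylor_realize {B : E4 →L[ℝ] E4 →L[ℝ] ℝ} {D₁ : E4 →L[ℝ] E4 →L[ℝ] E4 →L[ℝ] ℝ}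
    {D₂ : E4 →L[ℝ] E4 →L[ℝ] E4 →L[ℝ] E4 →L[ℝ] ℝ}
    (hB : ∀ v w, B v w = B w v) (hBi : B.IsInvertible) (hD₁ : ∀ z v w, D₁ z v w = D₁ z w v)
    (hD₂ : ∀ z z' v w, D₂ z z' v w = D₂ z z' w v) (hD₂c : ∀ v w, D₂ v w = D₂ w v) :
    IsMetricOn (taylor2 0 B D₁ D₂) {y | (taylor2 0 B D₁ D₂ y).IsInvertible} ∧
      (0 : E4) ∈ {y : E4 | (taylor2 0 B D₁ D₂ y).IsInvertible} ∧
      taylor2 0 B D₁ D₂ 0 = B ∧ fderiv ℝ (taylor2 0 B D₁ D₂) 0 = D₁ ∧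
      fderiv ℝ (fderiv ℝ (taylor2 0 B D₁ D₂)) 0 = D₂ :=
  ⟨isMetricOn_taylor2 hB hD₁ hD₂, by simpa using hBi, taylor2_self, fderiv_taylor2_self,
    fderiv_fderiv_taylor2 hD₂c 0⟩

/-- **Perturbing a symmetric jet along a covector by symmetric normal data keeps it symmetric**:
with `D₁' = D₁ + n ⊗ A` and `D₂'(v)(w) = D₂(v)(w) + n(v) P(w) + n(w) P(v) + n(v) n(w) W`, the data
`D₁' z`, `D₂' z z'` are symmetric forms and `D₂'` is symmetric in its differentiation slots.
[folklore] -/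
theorem momCap_perturb_symm {D₁ : E4 →L[ℝ] E4 →L[ℝ] E4 →L[ℝ] ℝ}
    {D₂ D₂' : E4 →L[ℝ] E4 →L[ℝ] E4 →L[ℝ] E4 →L[ℝ] ℝ} {n : E4 →L[ℝ] ℝ}
    {A : E4 →L[ℝ] E4 →L[ℝ] ℝ} {P : E4 →L[ℝ] E4 →L[ℝ] E4 →L[ℝ] ℝ} {W : E4 →L[ℝ] E4 →L[ℝ] ℝ}
    (hD₁ : ∀ z v w, D₁ z v w = D₁ z w v) (hD₂ : ∀ z z' v w, D₂ z z' v w = D₂ z z' w v)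
    (hD₂c : ∀ v w, D₂ v w = D₂ w v) (hA : ∀ v w, A v w = A w v) (hP : ∀ z v w, P z v w = P z w v)
    (hW : ∀ v w, W v w = W w v)
    (hD₂' : ∀ v, D₂' v = D₂ v + (n v • P + n.smulRight (P v) + n v • n.smulRight W)) :
    (∀ z v w, (D₁ + n.smulRight A) z v w = (D₁ + n.smulRight A) z w v) ∧
      (∀ z z' v w, D₂' z z' v w = D₂' z z' w v) ∧ (∀ v w, D₂' v w = D₂' w v) := by
  refine ⟨fun z v w ↦ ?_, fun z z' v w ↦ ?_, fun v w ↦ ?_⟩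
  · simp only [add_apply, ContinuousLinearMap.smulRight_apply,
      smul_apply, hD₁ z v w, hA v w]
  · rw [hD₂' z]
    simp only [add_apply, ContinuousLinearMap.smulRight_apply,
      smul_apply, hD₂ z z' v w, hP _ v w, hW v w]
  · rw [hD₂' v, hD₂' w]
    ext Y Z
    simp only [add_apply, ContinuousLinearMap.smulRight_apply,
      smul_apply, hD₂c v w, smul_eq_mul]
    ring

/-! ### The two halves of ML on jet space -/

/-- **ML(ii) on jet space.** If the mixed rows `Ric(G₁)(♯n, e) − Ric(G)(♯n, e)` (`n(e) = 0`) of two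
fields of metric components with the same value and jets differing along `n` by `(A, P, W)` are
bounded by `C(μ,ν)(1 + ‖DG(x)‖)(‖A‖ + ‖P‖)‖n‖²‖e‖` (the registered second half of
`stub_momRowLinear`, hypothesis `hML₂`), then the same bound holds for the Ricci jet function
`Ψ(J) = ricciJet J (B⁻¹ n) e` at a symmetric jet `J = (0, B, D₁, D₂)` with `μ`-coercive value of norm
`≤ ν` and its perturbation `(0, B, D₁ + n ⊗ A, D₂')` (realise both jets by Taylor fields). [folklore] -/
theorem momCap_jetML₂
    (hML₂ : ∀ μ ν : ℝ, 0 < μ → ∃ C : ℝ, ∀ {G G₁ : E4 → E4 →L[ℝ] E4 →L[ℝ] ℝ} {V : Set E4} {x : E4} {n : E4 →L[ℝ] ℝ} {A : E4 →L[ℝ] E4 →L[ℝ] ℝ} {P : E4 →L[ℝ] E4 →L[ℝ] E4 →L[ℝ] ℝ} {W : E4 →L[ℝ] E4 →L[ℝ] ℝ}, MetricCoord.IsMetricOn G V → MetricCoord.IsMetricOn G₁ V → x ∈ V → (∀ v : E4, μ * ‖v‖ ≤ ‖G x v‖) → ‖G x‖ ≤ ν → G₁ x = G x → fderiv ℝ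 G₁ x = fderiv ℝ G x + n.smulRight A → (∀ v, fderiv ℝ (fderiv ℝ G₁) x v = fderiv ℝ (fderiv ℝ G) x v + (n v • P + n.smulRight (P v) + n v • n.smulRight W)) → ∀ e : E4, n e = 0 → |MetricCoord.ricAt G₁ x (MetricCoord.sharpAt G x n) e - MetricCoord.ricAt G x (MetricCoord.sharpAt G x n) e| ≤ C * (1 + ‖fderiv ℝ G x‖) * (‖A‖ + ‖P‖) * ‖n‖ ^ 2 * ‖e‖)
    {μ ν : ℝ} (hμ : 0 < μ) :
    ∃ C : ℝ, ∀ {B : E4 →L[ℝ] E4 →L[ℝ] ℝ} {D₁ : E4 →L[ℝ] E4 →L[ℝ] E4 →L[ℝ] ℝ}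
      {D₂ D₂' : E4 →L[ℝ] E4 →L[ℝ] E4 →L[ℝ] E4 →L[ℝ] ℝ} {n : E4 →L[ℝ] ℝ} {A : E4 →L[ℝ] E4 →L[ℝ] ℝ}
      {P : E4 →L[ℝ] E4 →L[ℝ] E4 →L[ℝ] ℝ} {W : E4 →L[ℝ] E4 →L[ℝ] ℝ},
      (∀ v w, B v w = B w v) → B.IsInvertible → (∀ z v w, D₁ z v w = D₁ z w v) →
      (∀ z z' v w, D₂ z z' v w = D₂ z z' w v) → (∀ v w, D₂ v w = D₂ w v) →
      (∀ v w, A v w = A w v) → (∀ z v w, P z v w = P z w v) → (∀ v w, W v w = W w v) →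
      (∀ v, D₂' v = D₂ v + (n v • P + n.smulRight (P v) + n v • n.smulRight W)) →
      (∀ v : E4, μ * ‖v‖ ≤ ‖B v‖) → ‖B‖ ≤ ν → ∀ e : E4, n e = 0 →
      |ricciJet ((0 : E4), B, D₁ + n.smulRight A, D₂') (B.inverse n) e -
          ricciJet ((0 : E4), B, D₁, D₂) (B.inverse n) e| ≤
        C * (1 + ‖D₁‖) * (‖A‖ + ‖P‖) * ‖n‖ ^ 2 * ‖e‖ := by
  obtain ⟨C, hC⟩ := hML₂ μ ν hμ
  refine ⟨C, fun {B D₁ D₂ D₂' n A P W} hB hBi hD₁ hD₂ hD₂c hA hP hW hD₂' hcoer hν e he ↦ ?_⟩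
  obtain ⟨hG, h0, hG0, hG1, hG2⟩ := momCap_taylor_realize hB hBi hD₁ hD₂ hD₂c
  obtain ⟨hD₁', hD₂'s, hD₂'c⟩ := momCap_perturb_symm hD₁ hD₂ hD₂c hA hP hW hD₂'
  obtain ⟨hG', h0', hG0', hG1', hG2'⟩ := momCap_taylor_realize hB hBi hD₁' hD₂'s hD₂'c
  have hV : IsOpen ({y : E4 | (taylor2 0 B D₁ D₂ y).IsInvertible} ∩
      {y : E4 | (taylor2 0 B (D₁ + n.smulRight A) D₂' y).IsInvertible}) := hG.isOpen.inter hG'.isOpen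
  have hGV := KerrSchildChart.isMetricOn_mono hG hV inter_subset_left
  have hG'V := KerrSchildChart.isMetricOn_mono hG' hV inter_subset_right
  have key := hC hGV hG'V ⟨h0, h0'⟩ (by rw [hG0]; exact hcoer) (by rw [hG0]; exact hν)
    (by rw [hG0, hG0']) (by rw [hG1, hG1']) (fun v ↦ by rw [hG2, hG2', hD₂' v]) e he
  have hsharp : sharpAt (taylor2 0 B D₁ D₂) 0 = B.inverse := by
    simp only [sharpAt, taylor2_self]
  rw [hsharp, hG1] at key
  exact key

/-- **ML(i) on jet space (homogeneity).** If the mixed rows are additive and homogeneous in the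
normal data `(A, P)` and blind to `W` (the registered first half of `stub_momRowLinear`, hypothesis
`hML₁`), then for the Ricci jet function at a symmetric jet `J = (0, B, D₁, D₂)`:
`Ψ(0, B, D₁ + n ⊗ cA, D₂'') − Ψ(J) = c (Ψ(0, B, D₁ + n ⊗ A, D₂') − Ψ(J))`, where `D₂'`, `D₂''` are
the second components perturbed by `(P, W')` and `(cP, W)` (realise the three jets by Taylor
fields; the fourth field of ML(i) is the base field with zero data). [folklore] -/
theorem momCap_jetML₁_hom
    (hML₁ : ∀ {G G₁ G₂ G₃ : E4 → E4 →L[ℝ] E4 →L[ℝ] ℝ} {V : Set E4} {x : E4} {n : E4 →L[ℝ] ℝ} {A₁ A₂ : E4 →L[ℝ] E4 →L[ℝ] ℝ} {P₁ P₂ : E4 →L[ℝ] E4 →L[ℝ] E4 →L[ℝ] ℝ} {W₁ W₂ W₃ : E4 →L[ℝ] E4 →L[ℝ] ℝ} (c₁ c₂ : ℝ), MetricCoord.IsMetricOn G V → MetricCoord.IsMetricOn G₁ V → MetricCoord.IsMetricOn G₂ V → MetricCoord.IsMetricOn G₃ V → x ∈ V → G₁ x = G x → G₂ x = G x → G₃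 x = G x → fderiv ℝ G₁ x = fderiv ℝ G x + n.smulRight A₁ → fderiv ℝ G₂ x = fderiv ℝ G x + n.smulRight A₂ → fderiv ℝ G₃ x = fderiv ℝ G x + n.smulRight (c₁ • A₁ + c₂ • A₂) → (∀ v, fderiv ℝ (fderiv ℝ G₁) x v = fderiv ℝ (fderiv ℝ G) x v + (n v • P₁ + n.smulRight (P₁ v) + n v • n.smulRight W₁)) → (∀ v, fderiv ℝ (fderiv ℝ G₂) x v = fderiv ℝ (fderiv ℝ G) x v + (n v • P₂ + n.smulRight (P₂ v) + n v • n.smulRight W₂)) → (∀ v, fderiv ℝ (fderiv ℝ G₃) x v = fderiv ℝ (fderiv ℝ G) x v + (n v • (c₁ • P₁ + c₂ • P₂) + n.smulRight ((c₁ • P₁ + c₂ • P₂) v) + n v • n.smulRight W₃)) → ∀ e : E4, n e = 0 → MetricCoord.ricAt G₃ x (MetricCoord.sharpAt G x n) e - MetricCoord.ricAt G x (MetricCoord.sharpAt G x n) e = c₁ * (MetricCoord.ricAt G₁ x (MetricCoord.sharpAt G x n) e - MetricCoord.ricAt G x (MetricCoord.sharpAt G x n) e) + c₂ * (MetricCoord.ricAt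 G₂ x (MetricCoord.sharpAt G x n) e - MetricCoord.ricAt G x (MetricCoord.sharpAt G x n) e))
    {B : E4 →L[ℝ] E4 →L[ℝ] ℝ} {D₁ : E4 →L[ℝ] E4 →L[ℝ] E4 →L[ℝ] ℝ}
    {D₂ D₂' D₂'' : E4 →L[ℝ] E4 →L[ℝ] E4 →L[ℝ] E4 →L[ℝ] ℝ} {n : E4 →L[ℝ] ℝ} {A : E4 →L[ℝ] E4 →L[ℝ] ℝ}
    {P : E4 →L[ℝ] E4 →L[ℝ] E4 →L[ℝ] ℝ} {W W' : E4 →L[ℝ] E4 →L[ℝ] ℝ} (c : ℝ)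
    (hB : ∀ v w, B v w = B w v) (hBi : B.IsInvertible) (hD₁ : ∀ z v w, D₁ z v w = D₁ z w v)
    (hD₂ : ∀ z z' v w, D₂ z z' v w = D₂ z z' w v) (hD₂c : ∀ v w, D₂ v w = D₂ w v)
    (hA : ∀ v w, A v w = A w v) (hP : ∀ z v w, P z v w = P z w v) (hW : ∀ v w, W v w = W w v)
    (hW' : ∀ v w, W' v w = W' w v)
    (hD₂' : ∀ v, D₂' v = D₂ v + (n v • P + n.smulRight (P v) + n v • n.smulRight W'))
    (hD₂'' : ∀ v, D₂'' v = D₂ v + (n v • (c • P) + n.smulRight ((c • P) v) + n v • n.smulRight W))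
    (e : E4) (he : n e = 0) :
    ricciJet ((0 : E4), B, D₁ + n.smulRight (c • A), D₂'') (B.inverse n) e -
        ricciJet ((0 : E4), B, D₁, D₂) (B.inverse n) e =
      c * (ricciJet ((0 : E4), B, D₁ + n.smulRight A, D₂') (B.inverse n) e -
        ricciJet ((0 : E4), B, D₁, D₂) (B.inverse n) e) := by
  obtain ⟨hG, h0, hG0, hG1, hG2⟩ := momCap_taylor_realize hB hBi hD₁ hD₂ hD₂c
  obtain ⟨hD₁', hD₂'s, hD₂'c⟩ := momCap_perturb_symm hD₁ hD₂ hD₂c hA hP hW' hD₂'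
  obtain ⟨hG', h0', hG0', hG1', hG2'⟩ := momCap_taylor_realize hB hBi hD₁' hD₂'s hD₂'c
  have hcA : ∀ v w, (c • A) v w = (c • A) w v := fun v w ↦ by
    simp only [smul_apply, hA v w]
  have hcP : ∀ z v w, (c • P) z v w = (c • P) z w v := fun z v w ↦ by
    simp only [smul_apply, hP z v w]
  obtain ⟨hD₁'', hD₂''s, hD₂''c⟩ := momCap_perturb_symm hD₁ hD₂ hD₂c hcA hcP hW hD₂''
  obtain ⟨hG'', h0'', hG0'', hG1'', hG2''⟩ := momCap_taylor_realize hB hBi hD₁'' hD₂''s hD₂''c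
  have hV : IsOpen (({y : E4 | (taylor2 0 B D₁ D₂ y).IsInvertible} ∩
      {y : E4 | (taylor2 0 B (D₁ + n.smulRight A) D₂' y).IsInvertible}) ∩
      {y : E4 | (taylor2 0 B (D₁ + n.smulRight (c • A)) D₂'' y).IsInvertible}) :=
    (hG.isOpen.inter hG'.isOpen).inter hG''.isOpen
  have hGV := KerrSchildChart.isMetricOn_mono hG hV (inter_subset_left.trans inter_subset_left)
  have hG'V := KerrSchildChart.isMetricOn_mono hG' hV (inter_subset_left.trans inter_subset_right)
  have hG''V := KerrSchildChart.isMetricOn_mono hG'' hV inter_subset_right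
  have key := hML₁ (A₂ := 0) (P₂ := 0) (W₁ := W') (W₂ := 0) (W₃ := W) c 0 hGV hG'V hGV hG''V ⟨⟨h0, h0'⟩, h0''⟩
    (by rw [hG0, hG0']) rfl (by rw [hG0, hG0'']) (by rw [hG1, hG1']) (by simp)
    (by rw [hG1, hG1'']; simp) (fun v ↦ by rw [hG2, hG2', hD₂' v]) (fun v ↦ by simp)
    (fun v ↦ by rw [hG2, hG2'', hD₂'' v]; simp) e he
  have hsharp : sharpAt (taylor2 0 B D₁ D₂) 0 = B.inverse := by
    simp only [sharpAt, taylor2_self]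
  rw [hsharp, zero_mul, add_zero] at key
  exact key

/-! ### The rows of a field are the jet function of its jet at the base point `0` -/

/-- **`Ric(G)(x) = ricciJet (0, G x, DG x, D²G x)`**: the Ricci jet function does not see the base
point (translate `G` to `w ↦ G(x + w)`, `ricAt_comp_zoom_eq` with factor `1`, and read the jets of
the translate, `jets_comp_zoom`). [folklore] -/
theorem momCap_ricAt_eq_ricciJet_zero {G : E4 → E4 →L[ℝ] E4 →L[ℝ] ℝ} {V : Set E4} {x : E4}
    (hG : IsMetricOn G V) (hx : x ∈ V) :
    ricAt G x = ricciJet ((0 : E4), G x, fderiv ℝ G x, fderiv ℝ (fderiv ℝ G) x) := by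
  have hG1 := isMetricOn_comp_zoom hG x 1
  have hx' : x + (1 : ℝ) • (0 : E4) ∈ V := by simpa using hx
  have h0 : (0 : E4) ∈ (fun w : E4 ↦ x + (1 : ℝ) • w) ⁻¹' V := hx'
  have h1 := ricAt_comp_zoom_eq hG one_ne_zero (z := 0) hx'
  have h2 := ricAt_eq_ricciJet hG1 h0
  have hJ := jets_comp_zoom (c := (1 : ℝ)) hG.contDiffOn hG.isOpen hx
  rw [hJ.2.1, hJ.2.2, h1] at h2
  simp only [one_pow, one_smul, smul_zero, add_zero] at h2
  exact h2

/-- The same for a mixed row: `Ric(G)(x)(♯n, e) = ricciJet (0, G x, DG x, D²G x) ((G x)⁻¹ n) e`.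
[folklore] -/
theorem momCap_ricAt_sharp_eq_ricciJet_zero {G : E4 → E4 →L[ℝ] E4 →L[ℝ] ℝ} {V : Set E4} {x : E4}
    (hG : IsMetricOn G V) (hx : x ∈ V) (n : E4 →L[ℝ] ℝ) (e : E4) :
    ricAt G x (sharpAt G x n) e =
      ricciJet ((0 : E4), G x, fderiv ℝ G x, fderiv ℝ (fderiv ℝ G) x) ((G x).inverse n) e := by
  rw [momCap_ricAt_eq_ricciJet_zero hG hx]
  rfl

/-! ### Slice and normal data of a jet along `dx⁰` -/

/-- The spatial projection `π v = v − v⁰ e₀` does not increase the Euclidean norm. [folklore] -/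
theorem momCap_norm_proj_le (v : E4) :
    ‖(ContinuousLinearMap.id ℝ E4 - (E4.dx 0).smulRight (E4.basisVector 0)) v‖ ≤ ‖v‖ := by
  set w : E4 := (ContinuousLinearMap.id ℝ E4 - (E4.dx 0).smulRight (E4.basisVector 0)) v with hw
  have hw0 : w 0 = 0 := by simp [hw]
  have hsp : E4.spatial w = E4.spatial v := by
    ext i
    simp [hw, Fin.succ_ne_zero]
  have h1 : ‖w‖ ^ 2 ≤ ‖v‖ ^ 2 := by
    rw [norm_sq_eq_sq_add_spatialNorm_sq w, norm_sq_eq_sq_add_spatialNorm_sq v, E4.spatialNorm,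
      E4.spatialNorm, hsp, hw0]
    nlinarith [sq_nonneg (v 0)]
  exact (pow_le_pow_iff_left₀ (norm_nonneg w) (norm_nonneg v) two_ne_zero).1 h1

/-- The operator norm of the spatial projection is `≤ 1`. [folklore] -/
theorem momCap_norm_proj_le_one :
    ‖(ContinuousLinearMap.id ℝ E4 - (E4.dx 0).smulRight (E4.basisVector 0))‖ ≤ 1 :=
  ContinuousLinearMap.opNorm_le_bound _ zero_le_one fun v ↦ by
    rw [one_mul]; exact momCap_norm_proj_le v

/-- **Slice/normal split of a first jet along `dx⁰`**: `D₁ = D₁ ∘ π + dx⁰ ⊗ D₁(e₀)`. [folklore] -/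
theorem momCap_decomp₁ {F : Type*} [NormedAddCommGroup F] [NormedSpace ℝ F] (D₁ : E4 →L[ℝ] F) :
    D₁ = D₁.comp (ContinuousLinearMap.id ℝ E4 - (E4.dx 0).smulRight (E4.basisVector 0)) +
      (E4.dx 0).smulRight (D₁ (E4.basisVector 0)) := by
  ext v
  simp only [add_apply, ContinuousLinearMap.coe_comp, Function.comp_apply,
    sub_apply, ContinuousLinearMap.id_apply,
    ContinuousLinearMap.smulRight_apply, map_sub, map_smul]
  abel

/-- **Slice/normal split of a second jet along `dx⁰`** (symmetric in its differentiation slots):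
`D₂(v)(w) = D₂(πv)(πw) + v⁰ P(w) + w⁰ P(v) + v⁰ w⁰ W` with `P = D₂(e₀) ∘ π`, `W = D₂(e₀)(e₀)`.
[folklore] -/
theorem momCap_decomp₂ {F : Type*} [NormedAddCommGroup F] [NormedSpace ℝ F]
    (D₂ : E4 →L[ℝ] E4 →L[ℝ] F) (hc : ∀ v w, D₂ v w = D₂ w v) (v : E4) :
    D₂ v = (D₂.bilinearComp (ContinuousLinearMap.id ℝ E4 - (E4.dx 0).smulRight (E4.basisVector 0))
        (ContinuousLinearMap.id ℝ E4 - (E4.dx 0).smulRight (E4.basisVector 0))) v +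
      ((E4.dx 0) v • ((D₂ (E4.basisVector 0)).comp
          (ContinuousLinearMap.id ℝ E4 - (E4.dx 0).smulRight (E4.basisVector 0))) +
        (E4.dx 0).smulRight (((D₂ (E4.basisVector 0)).comp
          (ContinuousLinearMap.id ℝ E4 - (E4.dx 0).smulRight (E4.basisVector 0))) v) +
        (E4.dx 0) v • (E4.dx 0).smulRight (D₂ (E4.basisVector 0) (E4.basisVector 0))) := by
  ext w
  have h1 : D₂ v (E4.basisVector 0) = D₂ (E4.basisVector 0) v := hc _ _
  simp only [add_apply, ContinuousLinearMap.coe_comp, Function.comp_apply,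
    sub_apply, ContinuousLinearMap.id_apply, smul_apply,
    ContinuousLinearMap.smulRight_apply, ContinuousLinearMap.bilinearComp_apply, map_sub, map_smul]
  rw [h1]
  module

/-- **Registered one-line carrier form** (`momCap_ricAt_ricciJet_zero_sA`) of
`momCap_ricAt_eq_ricciJet_zero`: the Ricci form of metric components at `x` is the Ricci jet
function of their `2`-jet read at the base point `0`. [folklore] -/
theorem momCap_ricAt_ricciJet_zero_sA : open Literature.Geometry.Lorentzian in ∀ {G : E4 → E4 →L[ℝ] E4 →L[ℝ] ℝ} {V : Set E4} {x : E4}, MetricCoord.IsMetricOn G V → x ∈ V → MetricCoord.ricAt G x = MetricCoord.ricciJet ((0 : E4), G x, fderiv ℝ G x, fderiv ℝ (fderiv ℝ G) x) :=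
  fun hG hx ↦ momCap_ricAt_eq_ricciJet_zero hG hx

end Summit.FinalStateConjecture.FinalStateConjecture.Theorems.SublinearIsFree.Slaving

end
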